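import Summits.CriticalPhenomena.PercolationContinuityZ3.Theorems.PercNearOneGluingNoHeavyLowerTailKNConj4PreMargin
import Summits.CriticalPhenomena.PercolationContinuityZ3.Theorems.PercNearOneGluingNoHeavyLowerTailCSHTheoremOne
import Summits.CriticalPhenomena.PercolationContinuityZ3.Theorems.PercNearOneGluingNoHeavyLowerTailGpsiAllWeights
import Literature.Probability.Percolation.ConditionalPositiveAssociationProofs
import Literature.Probability.Percolation.KozmaNitzanClusterSizeReduction
import HarnessLib

/-!
# Kozma–Nitzan's Conjectures 4 and 2 for every relay set and EVERY weight vector (designated form + closure over degenerate weights)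

Support file (`--supports stmt-CriticalPhenomena-4575`), prover `prim-ineq-gen-6` (gen 8; memo FINDING-G8 §4).  No definitions, no named facts, no sorries.

* `PreFKGSurplus.kn_conj4_designated_holds` — the DESIGNATED form of Conjecture 4 at non-degenerate weights: for `c ∈ A` of least mean `E F(C c)`,
  `∫_{0↔A} F(C c) ≤ ∫_{0↔A} F(C 0)` — from the pre-FKG surplus margin (`PreFKGSurplus.preMargin_nonneg_of_csh`, this seat) and the conditioned slack
  hierarchy (`CSH.cshAll`, prim-ineq-prove-1 / prim-hp-8): peel one relay `k ≠ c`, vdBHK Thm 1.3 for `C_k` with the projected functional, and the two-observer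
  margin at `D = []`.
* `PreFKGSurplus.kn_conj4` — **Conjecture 4 for EVERY finite graph, EVERY weight vector in `[0,1]^E`, every `A ≠ ∅`, every `0`, every monotone `F`**, by
  prim-cplus-coupling's closure over degenerate weights `Q7Psi.kn_conj4_of_nondegenerate` fed with the designated form; `PreFKGSurplus.kn_conj2` — Conjecture 2 /
  display (3) for every `|A|` and every `b` (`KozmaNitzan2024_conjecture2_of_conjecture4_indicator`).
Printed status (arXiv:2401.12397): Conj. 4 proved for `|A| = 2` (Thm 7), `0` isolated off `A` (Thm 8), `f = 1{|C| ≥ k}`, `k ≤ 4` (Thm 9); `|A| = 3` is the tree's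
`Q7Psi.kn_conj4_three` (prim-cplus-coupling).
[cite: KozmaNitzan2024, Conj. 4 and Thms. 7–9 (p. 32), Conj. 2 (p. 3), Question 7 (p. 36)] [cite: VandenbergHaggstromKahn2005, Thm. 1.3 (p. 6), §2.1 Lemma 2.4 (p. 10)]
-/

noncomputable section

namespace Summit.CriticalPhenomena.PercolationContinuityZ3.Theorems

open MeasureTheory Set Literature.Probability.LatticeModels Literature.Probability.Percolation
open scoped Classical
open KNPreFKG CSH

namespace PreFKGSurplus

variable {n : ℕ}

/-- **Conjecture 4, designated form, non-degenerate weights**: for `c ∈ A` with `E F(C c) ≤ E F(C a)` for all `a ∈ A`,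
`∫_{0↔A} F(C c) ≤ ∫_{0↔A} F(C 0)`. [cite: KozmaNitzan2024, Conj. 4 (p. 32)] [cite: VandenbergHaggstromKahn2005, Thm. 1.3 (p. 6)] -/
theorem kn_conj4_designated_holds (w : Sym2 (Fin n) → unitInterval) (hw : ∀ e, 0 < w e ∧ w e < 1)
    (A : Finset (Fin n)) (o c : Fin n) (F : Set (Fin n) → ℝ) (hF : ∀ S T : Set (Fin n), S ⊆ T → F S ≤ F T) (hcA : c ∈ A)
    (hcmin : ∀ a ∈ A, ∫ ω, F (openCluster ω c) ∂(prodBernoulli w) ≤ ∫ ω, F (openCluster ω a) ∂(prodBernoulli w)) :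
    ∫ ω in ⋃ a' ∈ A, openConn o a', F (openCluster ω c) ∂(prodBernoulli w) ≤
      ∫ ω in ⋃ a' ∈ A, openConn o a', F (openCluster ω o) ∂(prodBernoulli w) := by
  classical
  set μ := prodBernoulli w with hμ
  have hmeas : ∀ S : Set (BondConfig (Fin n)), MeasurableSet S := fun _ => MeasurableSet.of_discrete
  have hint : ∀ (g : BondConfig (Fin n) → ℝ), Integrable g μ := fun g => Integrable.of_finite
  have hCSH := CSH.cshAll n w hw
  -- `o ∈ A`: `{o ↔ A}` is everything and the claim is `m_c ≤ m_o`
  by_cases hoA : o ∈ A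
  · have hU : (⋃ a' ∈ A, (openConn o a' : Set (BondConfig (Fin n)))) = univ := by
      refine eq_univ_of_forall fun ω => ?_
      exact (mem_iUnion_openConn A o ω).2 ⟨o, hoA, SimpleGraph.Reachable.refl _⟩
    rw [hU, Measure.restrict_univ]
    exact hcmin o hoA
  suffices hΔ : 0 ≤ ∫ ω in ⋃ a' ∈ A, openConn o a', (F (openCluster ω o) - F (openCluster ω c)) ∂μ by
    rw [integral_sub (hint _).integrableOn (hint _).integrableOn] at hΔ
    linarith
  -- peel one relay `k ≠ c` off `X := A` (no induction is needed at this stage: the two-observer margin does the work)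
  have main : ∀ (X : Finset (Fin n)), X ⊆ A → c ∈ X →
      0 ≤ ∫ ω in ⋃ a' ∈ X, openConn o a', (F (openCluster ω o) - F (openCluster ω c)) ∂μ := by
    intro X hXA hcX
    have hoX : o ∉ X := fun h => hoA (hXA h)
    rcases (X.erase c).eq_empty_or_nonempty with h0 | hne
    · have hXc : X = {c} := by rw [← Finset.insert_erase hcX, h0]; rfl
      rw [hXc]
      have hU : (⋃ a ∈ ({c} : Finset (Fin n)), (openConn o a : Set (BondConfig (Fin n)))) = openConn o c := by ext ω; simp
      rw [hU, setIntegral_congr_fun (hmeas _) (g := fun _ => (0 : ℝ)) (fun ω hω => by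
        show F (openCluster ω o) - F (openCluster ω c) = 0
        rw [openCluster_eq_of_reach (show (openGraph ω).Reachable o c from hω), sub_self])]
      simp
    obtain ⟨k, hk⟩ := hne
    have hkc : k ≠ c := (Finset.mem_erase.1 hk).1
    have hkX : k ∈ X := (Finset.mem_erase.1 hk).2
    set X' : Finset (Fin n) := X.erase k with hX'
    have hX'X : ∀ a ∈ X', a ∈ X := fun a ha => Finset.mem_of_mem_erase ha
    have hkX' : k ∉ X' := Finset.notMem_erase k X
    have hcX' : c ∈ X' := Finset.mem_erase.2 ⟨hkc.symm, hcX⟩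
    have hko : o ≠ k := fun h => hoX (h ▸ hkX)
    have hmk : ∫ ω, F (openCluster ω c) ∂μ ≤ ∫ ω, F (openCluster ω k) ∂μ := hcmin k (hXA hkX)
    set Dk : Set (BondConfig (Fin n)) := {ω : BondConfig (Fin n) | ∀ a ∈ (↑X' : Set (Fin n)), ¬ (openGraph ω).Reachable k a}
      with hDk
    set gk : BondConfig (Fin n) → ℝ := fun ω => F (openCluster ω k) - F (openCluster ω c) with hgk
    set Gk : Set (Sym2 (Fin n)) → ℝ := fun K => F {z | z = k ∨ ∃ e ∈ K, z ∈ e} -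
      ∫ η, F (openCluster (η \ BHK2006.barOf {k} K) c) ∂μ with hGk
    have hGk_mono : Monotone Gk := CovTau.monotone_projFun w c k F hF
    set Δo : ℝ := ∫ ω in ⋃ a' ∈ X', openConn o a', (F (openCluster ω o) - F (openCluster ω c)) ∂μ with hΔo
    set Δk : ℝ := ∫ ω in ⋃ a' ∈ X', openConn k a', (F (openCluster ω k) - F (openCluster ω c)) ∂μ with hΔk
    set Tko : ℝ := ∫ ω in Dk ∩ openConn k o, gk ω ∂μ with hTko
    set J : ℝ := ∫ ω in Dk, gk ω ∂μ with hJ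
    set M : ℝ := μ.real Dk with hM
    set E : ℝ := μ.real (Dk ∩ openConn k o) with hE
    -- peel
    have hpeel : ∫ ω in ⋃ a' ∈ X, openConn o a', (F (openCluster ω o) - F (openCluster ω c)) ∂μ = Δo + Tko := by
      rw [hΔo, hTko, hgk]
      exact preSurplus_erase_add w X F c k o hkX
    -- tower identities
    have hDk_S : ∀ u : Fin n, Dk ∩ openConn k u =
        {ω : BondConfig (Fin n) | ¬ (openGraph ω).Reachable k c} ∩
          {ω | openEdgeCluster ω k ∈ {K : Set (Sym2 (Fin n)) |
            (∀ a ∈ X', a ≠ c → ¬ (a = k ∨ ∃ e ∈ K, a ∈ e)) ∧ (u = k ∨ ∃ e ∈ K, u ∈ e)}} := by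
      intro u; ext ω
      simp only [mem_inter_iff, hDk, mem_setOf_eq, Finset.mem_coe]
      constructor
      · rintro ⟨h1, h2⟩
        refine ⟨h1 c hcX', fun a ha _ => ?_, (reachable_iff_exists_mem_openEdgeCluster ω k u).1 h2⟩
        rw [← reachable_iff_exists_mem_openEdgeCluster]; exact h1 a ha
      · rintro ⟨h1, h2, h3⟩
        refine ⟨fun a ha => ?_, (reachable_iff_exists_mem_openEdgeCluster ω k u).2 h3⟩
        by_cases hac : a = c
        · rw [hac]; exact h1
        · rw [reachable_iff_exists_mem_openEdgeCluster]; exact h2 a ha hac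
    have hDk_0 : Dk = {ω : BondConfig (Fin n) | ¬ (openGraph ω).Reachable k c} ∩
          {ω | openEdgeCluster ω k ∈ {K : Set (Sym2 (Fin n)) | ∀ a ∈ X', a ≠ c → ¬ (a = k ∨ ∃ e ∈ K, a ∈ e)}} := by
      ext ω
      simp only [mem_inter_iff, hDk, mem_setOf_eq, Finset.mem_coe]
      constructor
      · intro h1
        refine ⟨h1 c hcX', fun a ha _ => ?_⟩
        rw [← reachable_iff_exists_mem_openEdgeCluster]; exact h1 a ha
      · rintro ⟨h1, h2⟩ a ha
        by_cases hac : a = c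
        · rw [hac]; exact h1
        · rw [reachable_iff_exists_mem_openEdgeCluster]; exact h2 a ha hac
    have towO : Tko = ∫ ω in Dk ∩ openConn k o, Gk (openEdgeCluster ω k) ∂μ := by
      simp only [hTko, hgk]; rw [hDk_S o]; exact CovTau.setIntegral_sub_eq_projFun w c k F _
    have tow0 : J = ∫ ω in Dk, Gk (openEdgeCluster ω k) ∂μ := by
      simp only [hJ, hgk]; rw [hDk_0]; exact CovTau.setIntegral_sub_eq_projFun w c k F _
    have hJtot : J = ((∫ ω, F (openCluster ω k) ∂μ) - ∫ ω, F (openCluster ω c) ∂μ) - Δk := by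
      have h1 := integral_add_compl (hmeas Dk) (hint gk)
      have hDkc : Dkᶜ = ⋃ a' ∈ X', (openConn k a' : Set (BondConfig (Fin n))) := by
        ext ω
        rw [mem_iUnion_openConn, mem_compl_iff, hDk]
        simp only [mem_setOf_eq, Finset.mem_coe, not_forall, not_not, exists_prop]
      have h2 : ∫ ω in Dkᶜ, gk ω ∂μ = Δk := by
        rw [hDkc]
      have h3 : ∫ ω, gk ω ∂μ = (∫ ω, F (openCluster ω k) ∂μ) - ∫ ω, F (openCluster ω c) ∂μ := by
        rw [hgk, integral_sub (hint _) (hint _)]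
      rw [hJ]; linarith
    -- one-cluster positive association for `C_k` given `k ↮ X'`:  `M·Tko ≥ J·E`
    have hG : Monotone ((connFamily k o).indicator (1 : Set (Sym2 (Fin n)) → ℝ)) :=
      monotone_indicator_one_of_isUpperSet (isUpperSet_connFamily k o)
    have hPA := BHK2006_clusterConditionalPositiveAssociation_holds (Fin n) w k (↑X' : Set (Fin n)) Gk
      ((connFamily k o).indicator 1) hGk_mono hG (by exact_mod_cast hkX')
    have hind : (fun ω : BondConfig (Fin n) => (connFamily k o).indicator (1 : Set (Sym2 (Fin n)) → ℝ) (openEdgeCluster ω k)) =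
        (openConn k o : Set (BondConfig (Fin n))).indicator 1 := by
      rw [indicator_comp_openEdgeCluster (connFamily k o) k, ← openConn_eq_setOf_connFamily]
    have hI1 : ∫ ω in Dk, (connFamily k o).indicator (1 : Set (Sym2 (Fin n)) → ℝ) (openEdgeCluster ω k) ∂μ = E := by
      rw [show (fun ω => (connFamily k o).indicator (1 : Set (Sym2 (Fin n)) → ℝ) (openEdgeCluster ω k)) =
        (openConn k o : Set (BondConfig (Fin n))).indicator 1 from hind, setIntegral_indicator_one_eq]
    have hI2 : ∫ ω in Dk, Gk (openEdgeCluster ω k) * (connFamily k o).indicator (1 : Set (Sym2 (Fin n)) → ℝ) (openEdgeCluster ω k) ∂μ =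
        ∫ ω in Dk ∩ openConn k o, Gk (openEdgeCluster ω k) ∂μ := by
      have e : ∀ ω : BondConfig (Fin n), Gk (openEdgeCluster ω k) *
          (connFamily k o).indicator (1 : Set (Sym2 (Fin n)) → ℝ) (openEdgeCluster ω k) =
          Gk (openEdgeCluster ω k) * (openConn k o : Set (BondConfig (Fin n))).indicator (1 : BondConfig (Fin n) → ℝ) ω :=
        fun ω => congrArg (fun t => Gk (openEdgeCluster ω k) * t) (congrFun hind ω)
      simp_rw [e]
      exact setIntegral_mul_indicator_one μ Dk (openConn k o) _
    have hC : J * E ≤ M * Tko := by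
      have h := hPA
      rw [hI1, hI2, ← tow0, ← towO] at h
      rw [hM]
      linarith [h]
    -- the two-observer margin at `D = []`, observers `(o, k)`:  `Δo − (E/M)·Δk ≥ 0`
    have hpm := preMargin_nonneg_of_csh w hw o k
      (fun x Y D hxY hox hkx hoY hkY hD hDd => hCSH o k x Y D hko hxY hox hkx hoY hkY hD hDd)
      X' c [] F hF hcX' (fun a ha => hcmin a (hXA (hX'X a ha))) (fun h => hoX (hX'X o h)) hkX' List.nodup_nil
      (fun d hd => by simp at hd)
    simp only [decoyList, cshMarg_nil] at hpm
    -- identify the constant `obsConst w o k (↑X' ∪ ∅) = E / M`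
    have hset0 : ((↑X' : Set (Fin n)) ∪ {d | d ∈ ([] : List (Fin n))}) = ↑X' := by simp
    have hp0 : obsConst w o k ((↑X' : Set (Fin n)) ∪ {d | d ∈ ([] : List (Fin n))}) = E / M := by
      rw [hset0, obsConst, hE, hM, hDk, openConn_symm o k]
    rw [hp0] at hpm
    -- hpm : 0 ≤ Δo − (E/M)·Δk
    have hMpos : 0 < M := by
      refine prodBernoulli_real_pos_of_nonempty hw ⟨∅, ?_⟩
      intro a ha h
      rw [HullPort.reachable_empty_iff] at h
      exact hkX' (h ▸ (Finset.mem_coe.1 ha))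
    have hE0 : 0 ≤ E := measureReal_nonneg
    have hpm' : E * Δk ≤ M * Δo := by
      have : 0 ≤ M * (Δo - E / M * Δk) := mul_nonneg hMpos.le hpm
      have e : M * (Δo - E / M * Δk) = M * Δo - E * Δk := by field_simp
      linarith [this, e]
    -- induction hypothesis is not even needed beyond the margin: assemble
    have hmk' : 0 ≤ (∫ ω, F (openCluster ω k) ∂μ) - ∫ ω, F (openCluster ω c) ∂μ := by linarith [hmk]
    have hfin : 0 ≤ M * (Δo + Tko) := by
      have hJE : J * E = ((∫ ω, F (openCluster ω k) ∂μ) - ∫ ω, F (openCluster ω c) ∂μ) * E - Δk * E := by rw [hJtot]; ring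
      nlinarith [hC, hpm', hJE, mul_nonneg hmk' hE0]
    rw [hpeel]
    exact le_of_mul_le_mul_left (by rw [mul_zero]; exact hfin) hMpos
  exact main A (subset_refl A) hcA

/-- **KOZMA–NITZAN'S CONJECTURE 4 — every finite graph, every weight vector in `[0,1]^E`, every relay set `A ≠ ∅`, every `0`, every `F`
monotone on vertex sets**: some `a ∈ A` (a relay of least mean) has `E[F(C(a)); 0 ↔ A] ≤ E[F(C(0)); 0 ↔ A]`.
[cite: KozmaNitzan2024, Conj. 4 (p. 32)] -/
theorem kn_conj4 (w : Sym2 (Fin n) → unitInterval) (A : Finset (Fin n)) (o : Fin n) (F : Set (Fin n) → ℝ)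
    (hF : ∀ S T : Set (Fin n), S ⊆ T → F S ≤ F T) (hA : A.Nonempty) :
    ∃ a ∈ A, ∫ ω in ⋃ a' ∈ A, openConn o a', F (openCluster ω a) ∂(prodBernoulli w) ≤
      ∫ ω in ⋃ a' ∈ A, openConn o a', F (openCluster ω o) ∂(prodBernoulli w) :=
  Q7Psi.kn_conj4_of_nondegenerate
    (fun p hp A' o' c' F' hF' hc' hmin' => kn_conj4_designated_holds p hp A' o' c' F' hF' hc' hmin') w A o F hF hA

/-- **KOZMA–NITZAN'S CONJECTURE 2 (pre-FKG display (3)) — every finite graph, every weight vector, every relay set `A ≠ ∅`, all `0, b`**: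
some `a ∈ A` has `P(a ↔ b, 0 ↔ A) ≤ P(0 ↔ b, 0 ↔ A)`. [cite: KozmaNitzan2024, Conj. 2 / display (3) (p. 3), p. 32] -/
theorem kn_conj2 (w : Sym2 (Fin n) → unitInterval) (A : Finset (Fin n)) (o b : Fin n) (hA : A.Nonempty) :
    ∃ a ∈ A, (prodBernoulli w).real (openConn a b ∩ ⋃ a' ∈ A, openConn o a') ≤
      (prodBernoulli w).real (openConn o b ∩ ⋃ a' ∈ A, openConn o a') := by
  classical
  refine KozmaNitzan2024_conjecture2_of_conjecture4_indicator w A o b ?_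
  have hF : ∀ S T : Set (Fin n), S ⊆ T → (fun S : Set (Fin n) => if b ∈ S then (1 : ℝ) else 0) S ≤
      (fun S : Set (Fin n) => if b ∈ S then (1 : ℝ) else 0) T := by
    intro S T hST
    by_cases hS : b ∈ S
    · simp [hS, hST hS]
    · by_cases hT : b ∈ T
      · simp [hS, hT]
      · simp [hS, hT]
  exact kn_conj4 w A o (fun S => if b ∈ S then (1 : ℝ) else 0) hF hA

end PreFKGSurplus

end Summit.CriticalPhenomena.PercolationContinuityZ3.Theorems

end
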